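/-
Copyright (c) 2026 the pub-hodgecm-mathlib formalisation cell (harness21).  Prover seat hodgecm-mathlib-LH4-p19 (g4), req620 Track A «(D-RAM) FOUR-FRAME» squad
((β₂) road (R-36) «PURE-CELL LEDGER», lane C (RamM) LOWER-LINE RAY BAND ‹HL_RAY_C♭› — the KIT (split with LH4-p10 (g10) 04:18:40Z «=»), file KIT-2: the lower line's digit
constancy one digit deeper, lane-free (`hjiso` removed, nearness in `M`-currency)), 2026-09-05.
-/
import Summits.HodgeConjecture.HodgeConjecture.Theorems.F0P3cDyRamLowerLineDigitConstancy    -- ★ p864666 (LH7-p09 (g3)): the lane-B statement this file re-issues; §1 `v_one_sub_two_mul_le` BY NAME; brings ★ p864601 W1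
import HarnessLib

/-!
# Crux `H413`, line LH4 «(D-RAM) FOUR-FRAME» — the (β₂) road (R-36), (OFF) residue, LOWER line, ALL lanes: «DIGIT CONSTANCY ONE DIGIT DEEPER — `hjiso`-FREE RE-ISSUE» —
# ★ p864666 `…LowerLineDigitConstancy.litStar_iff_of_near_of_big` with the isometry letter `hjiso : |jE a| = |a|` REMOVED: the nearness of the two fixed digits is read in
# `M`-currency `|jE(V′ − V)| ≤ |jEϖ|^{2d−2}` and `|ϖ| < 1` as `|jEϖ| < 1`; conclusion BYTE-IDENTICAL

Cell `hodgecm-mathlib` (D-0151), FLOOR 0, crux item H413 = `stmt-HodgeConjecture-24833`, route of record `HCCMUnconditional`; squads F0∕P3c∕LH4 ∕ LH7; lane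
`--supports stmt-HodgeConjecture-24833 --as helper` (count-neutral; pays NO tier-0 row).  THEOREMS ONLY (no `def`, no instance, no notation, no `sorry`, default heartbeats);
★-only imports; states NO law; (β₂), ‹HL_RAY_C♭› stay HYPOTHESES of their consumers.

WHY (split LH4-p19 = KIT ∕ LH4-p10 = WORKER of the lane-C lower RAY band, 04:18:40Z; the pattern of ★ G3 p865045 ∕ ★ G3′ p865198 for the upper line).  ★ p864666 proves that
the literal predicate `LIT⋆(V) = (|κ₀ + jE V·ξ₀|·|cA| = |jEϖ|^b ∧ κ̂ρκ̂∕(hρh) ∈ N_Θ(Fix ρ))` is constant when the fixed digit moves by `|V′ − V| ≤ |ϖ|^{2d−2}` on a LARGE sphere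
(`1 ≤ |jEϖ|·|ξ₀|`, `|2| ≤ |jEϖ|`, `2 ≤ d`).  Its proof reads `hjiso` at exactly two places: to turn `|V′ − V| ≤ |ϖ|^{2d−2}` into `|jE(V′ − V)| ≤ |jEϖ|^{2d−2}` and `|ϖ| < 1` into
`|jEϖ| < 1`.  In lane C (RamM, `|jE a| = |a|²`) the worker holds the `M`-currency forms directly (★ `v_map_le_pow_iff`, ★ `v_map_lt_one_iff_of_le_iff` from `hjv`), so THIS FILE
takes them as the hypotheses: `(hnear : Valued.v (jE (V' - V)) ≤ Valued.v (jE ϖ) ^ (2 * d - 2))` in `hnear`'s slot and `(hϖlt : Valued.v (jE ϖ) < 1)` in `hϖlt`'s slot; the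
binder `hjiso` is dropped; nothing else moves (no valuation on `E` is used any more).  Every other line is ★ p864666's, VERBATIM; §1 `v_one_sub_two_mul_le` is used BY NAME.
* §1 `litStar_of_near_of_big_gen` (one direction), HEAD `litStar_iff_of_near_of_big_gen` — conclusions = ★'s, char-equal.  Lane B recovers ★ (`hnear` ⟸ `hjiso` + E-nearness).
WHAT IS NOT CLAIMED: the reference pair, `|γ₁| = 1`, the large-sphere letters, (hbase), any count, any census law.
HONEST LABEL.  Count-neutral valuation algebra; nothing printed is asserted; no census law is stated; ‹HL_RAY_C♭›, ‹HL_MIX_C♭›, β₂ `stub_law_cleanSgn₂` UNPROVED; `HC_CM` is proved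
only modulo the 7 printed citations (2 remaining named inputs: hLiu418 = `stmt-HodgeConjecture-24832`, h413 = `stmt-HodgeConjecture-24833`) until rung 0 closes.
## References
* [Serre1979] J.-P. Serre, *Local Fields*, GTM 67 (1979): Ch. V §3 Cor. 3 pp. 85–87 (`U^{(n)} ⊆ N` for `n ≥ 2d − 1`; conductor of `ω`), Ch. XV §2.
* [Rogawski1990] J. D. Rogawski, *Automorphic Representations of Unitary Groups in Three Variables*, Ann. of Math. Stud. 123 (1990): §4.9 Prop. 4.9.1 (b) p. 55.
* [Kottwitz1986BaseChangeUnits] R. E. Kottwitz, *Base change for unit elements of Hecke algebras*, Compositio Math. 60 (1986): §3 (the digit fibration of a cone cell).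
-/

set_option autoImplicit false

noncomputable section

namespace Summit.HodgeConjecture.HodgeConjecture.Cruxes.H413.F0P3cDyRamLowerLineDigitConstancyGen

open scoped Valued WithZero
open WithZero
open Summit.HodgeConjecture.HodgeConjecture.Cruxes.H413.F0P3cDyRamLowerLineDigitConstancy (v_one_sub_two_mul_le)

variable {E M : Type} [Field E] [Field M] [Valued M ℤᵐ⁰] {ρ Θ : M →+* M}   -- no valuation on `E` is used: the nearness letter lives in `M`

/-! ## §1 One direction -/

/-- **ONE DIRECTION OF THE HEAD** (the statement is symmetric in `V, V′`): `LIT⋆ V → LIT⋆ V′` for fixed digits `V, V′` with `|jE(V′ − V)| ≤ |jEϖ|^{2d−2}` (`M`-currency),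
given ★ p864601 §1's letters (reference pair, `|ξ₀|·|cA| = |jEϖ|^b`, `hdeep` at depth `2d − 1`) and the lower-line letters `1 ≤ |jEϖ|·|ξ₀|`, `|2| ≤ |jEϖ|`, `2 ≤ d`, `|jEϖ| < 1`.
(★ p864666 `litStar_of_near_of_big` with `hjiso` dropped, `hnear`∕`hϖlt` read in `M`; proof VERBATIM otherwise: `κ̂′ = κ̂ + η`, `|η| ≤ |jEϖ|^{2d−2}|κ̂| < |κ̂|`, `w − 1 =
(η(ρκ̂ − κ̂) − η²)∕(κ̂ρκ̂)`, `|ρκ̂ − κ̂| = |1 − 2κ̂| ≤ |jEϖ||κ̂|` (★ §1) ⟹ `|w − 1| ≤ |jEϖ|^{2d−1}` ⟹ `w ∈ N_Θ(Fix ρ)`.)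
[cite: Serre1979, Ch. V §3 Cor. 3 pp. 85–87] [cite: Rogawski1990, §4.9 Prop. 4.9.1 (b) p. 55] [cite: Kottwitz1986BaseChangeUnits, §3] -/
theorem litStar_of_near_of_big_gen {σ : E →+* E} {ϖ : E} {d : ℕ}
    (jE : E →+* M) (hjfix : ∀ z, ρ z = z ↔ ∃ c, jE c = z) (hΘj : ∀ c, Θ (jE c) = jE (σ c))
    (hρρ : ∀ x, ρ (ρ x) = x) (hvρ : ∀ x, Valued.v (ρ x) = Valued.v x) (hΘρ : ∀ x, Θ (ρ x) = ρ (Θ x))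
    {κ₀ ξ₀ : M} (hκ₀ : κ₀ + ρ κ₀ = 1) (hΘκ₀ : Θ κ₀ = κ₀) (hξ : ρ ξ₀ = -ξ₀) (hΘξ : Θ ξ₀ = ξ₀) (hξ0 : ξ₀ ≠ 0)
    {cA hM : M} {b : ℕ} (hRe : Valued.v ξ₀ * Valued.v cA = Valued.v (jE ϖ) ^ b) (hϖ0 : jE ϖ ≠ 0)
    (hdeep : ∀ u : M, ρ u = u → Θ u = u → Valued.v (u - 1) ≤ Valued.v (jE ϖ) ^ (2 * d - 1) → ∃ c : M, ρ c = c ∧ c * Θ c = u)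
    (hbig : 1 ≤ Valued.v (jE ϖ) * Valued.v ξ₀) (h2 : Valued.v (2 : M) ≤ Valued.v (jE ϖ)) (hd2 : 2 ≤ d) (hϖlt : Valued.v (jE ϖ) < 1)
    {V V' : E} (hσV : σ V = V) (hσV' : σ V' = V') (hnear : Valued.v (jE (V' - V)) ≤ Valued.v (jE ϖ) ^ (2 * d - 2))
    (hL : Valued.v (κ₀ + jE V * ξ₀) * Valued.v cA = Valued.v (jE ϖ) ^ b ∧
      ∃ e : M, ρ e = e ∧ e * Θ e = (κ₀ + jE V * ξ₀) * ρ (κ₀ + jE V * ξ₀) / (hM * ρ hM)) :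
    Valued.v (κ₀ + jE V' * ξ₀) * Valued.v cA = Valued.v (jE ϖ) ^ b ∧
      ∃ e : M, ρ e = e ∧ e * Θ e = (κ₀ + jE V' * ξ₀) * ρ (κ₀ + jE V' * ξ₀) / (hM * ρ hM) := by
  obtain ⟨hLv, e, hρe, he⟩ := hL
  have hρj : ∀ c : E, ρ (jE c) = jE c := fun c => (hjfix _).2 ⟨c, rfl⟩
  have hcA0 : Valued.v cA ≠ 0 := fun h0 => by
    rw [h0, mul_zero] at hRe; exact pow_ne_zero _ ((Valuation.ne_zero_iff _).2 hϖ0) hRe.symm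
  set κ : M := κ₀ + jE V * ξ₀ with hκdef
  set η : M := jE (V' - V) * ξ₀ with hηdef
  have hκ' : κ₀ + jE V' * ξ₀ = κ + η := by rw [hκdef, hηdef, map_sub]; ring
  -- sizes: `|κ| = |ξ₀|`, `|η| ≤ |jEϖ|^{2d−2}·|κ| < |κ|`
  have hκv : Valued.v κ = Valued.v ξ₀ := mul_right_cancel₀ hcA0 (hLv.trans hRe.symm)
  have hξpos : (0 : ℤᵐ⁰) < Valued.v ξ₀ := zero_lt_iff.2 ((Valuation.ne_zero_iff _).2 hξ0)
  have hηv : Valued.v η ≤ Valued.v (jE ϖ) ^ (2 * d - 2) * Valued.v κ := by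
    rw [hηdef, Valuation.map_mul, hκv]; exact mul_le_mul' hnear le_rfl
  have hpow_lt : Valued.v (jE ϖ) ^ (2 * d - 2) < 1 := pow_lt_one₀ zero_le hϖlt (by omega)
  have hηlt : Valued.v η < Valued.v κ := by
    refine hηv.trans_lt ?_
    calc Valued.v (jE ϖ) ^ (2 * d - 2) * Valued.v κ < 1 * Valued.v κ := by
          rw [hκv]; exact mul_lt_mul_of_pos_right hpow_lt hξpos
      _ = Valued.v κ := one_mul _
  have hκ0 : κ ≠ 0 := fun h0 => by rw [h0, map_zero] at hκv; exact hξ0 ((Valuation.zero_iff _).1 hκv.symm)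
  have hρκ : ρ κ = 1 - κ := by
    rw [hκdef, map_add, map_mul, hρj, hξ, mul_neg, ← hκ₀]; ring
  have hρκ0 : ρ κ ≠ 0 := fun h0 => hκ0 (by rw [← hρρ κ, h0, map_zero])
  have hρη : ρ η = -η := by rw [hηdef, map_mul, hρj, hξ, mul_neg]
  have hΘκ : Θ κ = κ := by rw [hκdef, map_add, map_mul, hΘκ₀, hΘj, hσV, hΘξ]
  have hΘη : Θ η = η := by rw [hηdef, map_mul, hΘj, map_sub, hσV, hσV', hΘξ, map_sub]
  -- the lower line's extra digit: `|ρκ − κ| = |1 − 2κ| ≤ |jEϖ|·|κ|`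
  have hskew : Valued.v (ρ κ - κ) ≤ Valued.v (jE ϖ) * Valued.v κ := by
    rw [hρκ, show (1 : M) - κ - κ = 1 - 2 * κ by ring]
    exact v_one_sub_two_mul_le (by rw [hκv]; exact hbig) h2
  -- the twist `w = κ′ρκ′ ∕ (κρκ)`
  set w : M := (κ + η) * ρ (κ + η) / (κ * ρ κ) with hwdef
  have hρw : ρ w = w := by
    rw [hwdef, map_div₀, map_mul, map_mul, hρρ, hρρ]; ring
  have hΘw : Θ w = w := by
    rw [hwdef, map_div₀, map_mul, map_mul, hΘρ, hΘρ, map_add, hΘκ, hΘη]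
  have hw1 : w - 1 = (η * (ρ κ - κ) - η * η) / (κ * ρ κ) := by
    rw [hwdef, map_add, hρη]; field_simp; ring
  have hwv : Valued.v (w - 1) ≤ Valued.v (jE ϖ) ^ (2 * d - 1) := by
    rw [hw1, Valuation.map_div, Valuation.map_mul, hvρ]
    have hκpos : (0 : ℤᵐ⁰) < Valued.v κ * Valued.v κ := mul_pos (hκv ▸ hξpos) (hκv ▸ hξpos)
    rw [div_le_iff₀ hκpos]
    have hexp : Valued.v (jE ϖ) ^ (2 * d - 2) * Valued.v (jE ϖ) = Valued.v (jE ϖ) ^ (2 * d - 1) := by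
      rw [← pow_succ, show 2 * d - 2 + 1 = 2 * d - 1 by omega]
    have h1 : Valued.v (η * (ρ κ - κ)) ≤ Valued.v (jE ϖ) ^ (2 * d - 1) * (Valued.v κ * Valued.v κ) := by
      rw [Valuation.map_mul]
      calc Valued.v η * Valued.v (ρ κ - κ) ≤ Valued.v (jE ϖ) ^ (2 * d - 2) * Valued.v κ * (Valued.v (jE ϖ) * Valued.v κ) := mul_le_mul' hηv hskew
        _ = Valued.v (jE ϖ) ^ (2 * d - 2) * Valued.v (jE ϖ) * (Valued.v κ * Valued.v κ) := by ac_rfl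
        _ = Valued.v (jE ϖ) ^ (2 * d - 1) * (Valued.v κ * Valued.v κ) := by rw [hexp]
    have h2' : Valued.v (η * η) ≤ Valued.v (jE ϖ) ^ (2 * d - 1) * (Valued.v κ * Valued.v κ) := by
      rw [Valuation.map_mul]
      have hjϖ1 : Valued.v (jE ϖ) ≤ 1 := hϖlt.le
      calc Valued.v η * Valued.v η ≤ Valued.v (jE ϖ) ^ (2 * d - 2) * Valued.v κ * (Valued.v (jE ϖ) ^ (2 * d - 2) * Valued.v κ) := mul_le_mul' hηv hηv
        _ = Valued.v (jE ϖ) ^ (2 * d - 2 + (2 * d - 2)) * (Valued.v κ * Valued.v κ) := by rw [pow_add]; ac_rfl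
        _ ≤ Valued.v (jE ϖ) ^ (2 * d - 1) * (Valued.v κ * Valued.v κ) :=
          mul_le_mul' (pow_le_pow_right_of_le_one' hjϖ1 (by omega)) le_rfl
    exact (Valuation.map_sub _ _ _).trans (max_le h1 h2')
  obtain ⟨c, hρc, hc⟩ := hdeep w hρw hΘw hwv
  refine ⟨?_, c * e, by rw [map_mul, hρc, hρe], ?_⟩
  · rw [hκ', Valuation.map_add_eq_of_lt_left _ hηlt]; exact hLv
  · have hcc : c * e * Θ (c * e) = w * ((κ + η - η) * ρ (κ + η - η) / (hM * ρ hM)) := by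
      rw [map_mul, add_sub_cancel_right, ← he, ← hc]; ring
    rw [hcc, hκ', hwdef, add_sub_cancel_right]
    field_simp

/-! ## §2 HEAD -/

/-- **HEAD — «ON THE LOWER LINE `LIT⋆` IS CONSTANT ON `|jEϖ|^{2d−2}`-BALLS OF FIXED DIGITS» (`hjiso`-free re-issue of ★ p864666's HEAD).**  ★ p864601 §1's letters
(`jE`-letters through `hjfix hΘj`, `ρ ∘ ρ = 1`, `ρ` isometric, `Θρ = ρΘ`; the reference pair `κ₀, ξ₀`; `|ξ₀|·|cA| = |jEϖ|^b`; the norm letter `hdeep` at depth `2d − 1`) + `1 ≤ |jEϖ|·|ξ₀|`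
(large sphere, `b < j`), `|2| ≤ |jEϖ|` (dyadic), `2 ≤ d`, `|jEϖ| < 1`.  THEN for fixed `V, V′` with `|jE(V′ − V)| ≤ |jEϖ|^{2d−2}`: `LIT⋆ V ↔ LIT⋆ V′`,
`LIT⋆ V :≡ |κ₀ + jE V·ξ₀|·|cA| = |jEϖ|^b ∧ ∃ e ∈ Fix ρ, eΘe = κ̂ρκ̂∕(hρh)` — ★ F1's `hC` for the lower line at `|γ₁| = 1`; conclusion = ★'s, char-equal.
[cite: Serre1979, Ch. V §3 Cor. 3 pp. 85–87] [cite: Rogawski1990, §4.9 Prop. 4.9.1 (b) p. 55] [cite: Kottwitz1986BaseChangeUnits, §3] -/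
theorem litStar_iff_of_near_of_big_gen {σ : E →+* E} {ϖ : E} {d : ℕ}
    (jE : E →+* M) (hjfix : ∀ z, ρ z = z ↔ ∃ c, jE c = z) (hΘj : ∀ c, Θ (jE c) = jE (σ c))
    (hρρ : ∀ x, ρ (ρ x) = x) (hvρ : ∀ x, Valued.v (ρ x) = Valued.v x) (hΘρ : ∀ x, Θ (ρ x) = ρ (Θ x))
    {κ₀ ξ₀ : M} (hκ₀ : κ₀ + ρ κ₀ = 1) (hΘκ₀ : Θ κ₀ = κ₀) (hξ : ρ ξ₀ = -ξ₀) (hΘξ : Θ ξ₀ = ξ₀) (hξ0 : ξ₀ ≠ 0)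
    {cA hM : M} {b : ℕ} (hRe : Valued.v ξ₀ * Valued.v cA = Valued.v (jE ϖ) ^ b) (hϖ0 : jE ϖ ≠ 0)
    (hdeep : ∀ u : M, ρ u = u → Θ u = u → Valued.v (u - 1) ≤ Valued.v (jE ϖ) ^ (2 * d - 1) → ∃ c : M, ρ c = c ∧ c * Θ c = u)
    (hbig : 1 ≤ Valued.v (jE ϖ) * Valued.v ξ₀) (h2 : Valued.v (2 : M) ≤ Valued.v (jE ϖ)) (hd2 : 2 ≤ d) (hϖlt : Valued.v (jE ϖ) < 1)
    {V V' : E} (hσV : σ V = V) (hσV' : σ V' = V') (hnear : Valued.v (jE (V' - V)) ≤ Valued.v (jE ϖ) ^ (2 * d - 2)) :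
    (Valued.v (κ₀ + jE V * ξ₀) * Valued.v cA = Valued.v (jE ϖ) ^ b ∧
        ∃ e : M, ρ e = e ∧ e * Θ e = (κ₀ + jE V * ξ₀) * ρ (κ₀ + jE V * ξ₀) / (hM * ρ hM)) ↔
      (Valued.v (κ₀ + jE V' * ξ₀) * Valued.v cA = Valued.v (jE ϖ) ^ b ∧
        ∃ e : M, ρ e = e ∧ e * Θ e = (κ₀ + jE V' * ξ₀) * ρ (κ₀ + jE V' * ξ₀) / (hM * ρ hM)) := by
  have hnear' : Valued.v (jE (V - V')) ≤ Valued.v (jE ϖ) ^ (2 * d - 2) := by rw [← neg_sub, map_neg, Valuation.map_neg]; exact hnear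
  exact ⟨litStar_of_near_of_big_gen jE hjfix hΘj hρρ hvρ hΘρ hκ₀ hΘκ₀ hξ hΘξ hξ0 hRe hϖ0 hdeep hbig h2 hd2 hϖlt hσV hσV' hnear,
    litStar_of_near_of_big_gen jE hjfix hΘj hρρ hvρ hΘρ hκ₀ hΘκ₀ hξ hΘξ hξ0 hRe hϖ0 hdeep hbig h2 hd2 hϖlt hσV' hσV hnear'⟩

end Summit.HodgeConjecture.HodgeConjecture.Cruxes.H413.F0P3cDyRamLowerLineDigitConstancyGen

end
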